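import Mathlib.Analysis.Calculus.ContDiff.Convolution
import Literature.Analysis.FluidPDE.HessianLaplacianLp
import Literature.Analysis.FluidPDE.ClassicalSolutionCalculus
import HarnessLib

/-!
# The truncated Newtonian potential of a space–time test function

Analysis/FluidPDE support file (all results proved) in the decomposition of the named fact
`Literature.Analysis.FluidPDE.LemarieRieusset2016.pressure_localIntegrability`
(`CKNMorreyLemmas.lean`; Lemarié-Rieusset 2016, (13.20), p. 461: the splitting of the pressure
through the Newtonian kernel). The printed argument applies the Newtonian kernel `G = 1/(4π|x|)`
to the cut-off pressure `ζ_B p`; here the kernel is replaced by the tree's **truncated** Newtonian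
kernel `Γ₀ = θΓ` at radii `(ρ₀, ρ₁)` (`newtonNear`, `FluidPDE/NewtonKernel`; compactly supported
in `|z| ≤ ρ₁`) and it is applied on the side of the **test function**: for a space–time test
function `θ ∈ C_c^∞(I × B(x_B, R))` the slicewise truncated potential

  `Θ(t, x) = N[θ(t, ·)](x) = ∫ Γ₀(z) θ(t, x - z) dz`  (`newtonNearPotential ρ₀ ρ₁ (θ t) x`)

is again a space–time test function, on the slightly larger cylinder `I × B(x_B, R + ρ₁)`
(`IsSpaceTimeTestOn.newtonNearPotential_slice`: joint smoothness is Mathlib's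
`contDiffOn_convolution_right_with_param`, the support grows by `ρ₁` in `x`), and its slice
Laplacian is `Δₓ Θ = θ - Λ[θ(t, ·)]` with the smoothing remainder `Λ[g] = λ ⋆ g`,
`λ = Δ((1 - θ)Γ)` smooth and supported in `|z| ≤ ρ₁` (`laplacian_newtonNearPotential`,
`FluidPDE/NewtonLocalPotential`). Tested against the pressure equation
`Δp = -∑ ∂ᵢ∂ⱼ(uᵢuⱼ)` (`DistributionalPressurePoisson`), `Θ` turns `∫∫ p θ` into
`∫∫ p Λθ - ∫∫ D²ₓΘ(u, u)`; the first term is a smooth average of `p` (the part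
`p_B ∈ L^{q₀}_t L^∞_x` of (13.20)) and the second is controlled by `‖u‖²_{L^{10/3}} ‖θ‖_{L^{5/2}}`
through the `L^{5/2}` bound for the Hessian of `N` (`stein1970_hessian_Lp_bound`, Stein 1970,
III §1.3 Prop. 3, via `hessian_newtonNearPotential_half`), which is the part `ϖ_B ∈ L^{5/3}_{t,x}`.
This file provides the test-function side of that computation:

* `newtonNearPotential_eq_convolution`; joint smoothness of `(t, x) ↦ N[θ(t,·)](x)` and of
  `(t, x) ↦ Λ[θ(t,·)](x)` (`contDiff_uncurry_newtonNearPotential_slice`,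
  `contDiff_uncurry_newtonFarSmoothing_slice`);
* supports: `tsupport ⊆ I × B(x_B, R + ρ₁)` for both (`tsupport_newtonNearPotential_slice_subset`,
  `tsupport_newtonFarSmoothing_slice_subset`), and the test-function property of `Θ`
  (`IsSpaceTimeTestOn.newtonNearPotential_slice`);
* the pointwise bound for the Hessian quadratic form by the coordinate second derivatives,
  `|D²g(x)(v, v)| ≤ ‖v‖² ∑ᵢⱼ |∂ⱼ∂ᵢ g(x)|` (`abs_fderiv_fderiv_apply_le_norm_sq_mul_sum`).

## References

* P. G. Lemarié-Rieusset, *The Navier–Stokes Problem in the 21st Century*, CRC Press (2016),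
  (13.20) p. 461. [LemarieRieusset2016]
* D. Gilbarg, N. S. Trudinger, *Elliptic partial differential equations of second order*
  (2001), (2.16)–(2.17) (Green's representation with a cut-off kernel). [GilbargTrudinger2001]
-/

noncomputable section

open MeasureTheory Set Function Filter Topology TopologicalSpace Metric InnerProductSpace
open scoped ENNReal NNReal RealInnerProductSpace ContDiff Laplacian Convolution

namespace Literature.Analysis.FluidPDE

variable {ρ₀ ρ₁ : ℝ}

/-! ### The truncated potential as a convolution; joint smoothness in `(t, x)` -/

/-- `N[g] = Γ₀ ⋆ g` (Mathlib convolution for the pairing `lsmul`). [folklore] -/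
theorem newtonNearPotential_eq_convolution (ρ₀ ρ₁ : ℝ) (g : EuclideanSpace ℝ (Fin 3) → ℝ) :
    newtonNearPotential ρ₀ ρ₁ g =
      newtonNear ρ₀ ρ₁ ⋆[ContinuousLinearMap.lsmul ℝ ℝ, volume] g := by
  funext x; rw [convolution_lsmul_apply]; rfl

/-- **Joint smoothness of the slicewise truncated potential of a test function**: for
`θ ∈ C_c^∞(Q)`, `Q ⊆ ℝ × ℝ³` open, and `0 ≤ ρ₀ < ρ₁`, the function `(t, x) ↦ N[θ(t, ·)](x)` is
`C^∞` on `ℝ × ℝ³` (Mathlib's `contDiffOn_convolution_right_with_param` with the time as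
parameter: `Γ₀ ∈ L¹_loc`, `θ` jointly smooth with `x`-supports in a fixed compact set).
[folklore] -/
theorem contDiff_uncurry_newtonNearPotential_slice {Q : Opens (ℝ × EuclideanSpace ℝ (Fin 3))}
    {θ : ℝ → EuclideanSpace ℝ (Fin 3) → ℝ} (hθ : IsSpaceTimeTestOn Q θ) (h₀ : 0 ≤ ρ₀)
    (h₁ : ρ₀ < ρ₁) : ContDiff ℝ ∞ (uncurry fun t => newtonNearPotential ρ₀ ρ₁ (θ t)) := by
  obtain ⟨K, hK, hKt⟩ := hθ.exists_compact_slice_subset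
  have hgs : ∀ (t : ℝ) (x : EuclideanSpace ℝ (Fin 3)), t ∈ (univ : Set ℝ) → x ∉ K → θ t x = 0 :=
    fun t x _ hx => image_eq_zero_of_notMem_tsupport fun h => hx (hKt t h)
  have h := contDiffOn_convolution_right_with_param (𝕜 := ℝ) (n := (⊤ : ℕ∞))
    (ContinuousLinearMap.lsmul ℝ ℝ) (g := θ) isOpen_univ hK hgs
    (integrable_newtonNear h₀ h₁).locallyIntegrable
    (by rw [univ_prod_univ]; exact hθ.contDiff.contDiffOn)
  rw [univ_prod_univ, contDiffOn_univ] at h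
  have hfun : (uncurry fun t => newtonNearPotential ρ₀ ρ₁ (θ t)) =
      fun q : ℝ × EuclideanSpace ℝ (Fin 3) =>
        (newtonNear ρ₀ ρ₁ ⋆[ContinuousLinearMap.lsmul ℝ ℝ, volume] θ q.1) q.2 := by
    funext q
    change newtonNearPotential ρ₀ ρ₁ (θ q.1) q.2 = _
    rw [newtonNearPotential_eq_convolution]
  rw [hfun]
  exact h

/-- Joint smoothness of the slicewise smoothing remainder `(t, x) ↦ Λ[θ(t, ·)](x)` of a test
function (`λ` is smooth with compact support, in particular locally integrable). [folklore] -/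
theorem contDiff_uncurry_newtonFarSmoothing_slice {Q : Opens (ℝ × EuclideanSpace ℝ (Fin 3))}
    {θ : ℝ → EuclideanSpace ℝ (Fin 3) → ℝ} (hθ : IsSpaceTimeTestOn Q θ) (h₀ : 0 < ρ₀)
    (h₁ : ρ₀ < ρ₁) : ContDiff ℝ ∞ (uncurry fun t => newtonFarSmoothing ρ₀ ρ₁ (θ t)) := by
  obtain ⟨K, hK, hKt⟩ := hθ.exists_compact_slice_subset
  have hgs : ∀ (t : ℝ) (x : EuclideanSpace ℝ (Fin 3)), t ∈ (univ : Set ℝ) → x ∉ K → θ t x = 0 :=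
    fun t x _ hx => image_eq_zero_of_notMem_tsupport fun h => hx (hKt t h)
  have h := contDiffOn_convolution_right_with_param (𝕜 := ℝ) (n := (⊤ : ℕ∞))
    (ContinuousLinearMap.lsmul ℝ ℝ) (g := θ) isOpen_univ hK hgs
    (integrable_newtonFarLaplacian h₀ h₁).locallyIntegrable
    (by rw [univ_prod_univ]; exact hθ.contDiff.contDiffOn)
  rw [univ_prod_univ, contDiffOn_univ] at h
  have hfun : (uncurry fun t => newtonFarSmoothing ρ₀ ρ₁ (θ t)) =
      fun q : ℝ × EuclideanSpace ℝ (Fin 3) =>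
        (newtonFarLaplacian ρ₀ ρ₁ ⋆[ContinuousLinearMap.lsmul ℝ ℝ, volume] θ q.1) q.2 := by
    funext q
    change newtonFarSmoothing ρ₀ ρ₁ (θ q.1) q.2 = _
    rw [newtonFarSmoothing_eq_convolution]
  rw [hfun]
  exact h

/-! ### Supports -/

/-- The support of the slicewise truncated potential: if `θ` is supported in the closed set
`T ⊆ ℝ × ℝ³` then `N[θ(t,·)](x) ≠ 0` forces `(t, x - z) ∈ T` for some `|z| ≤ ρ₁`, so the
topological support of `(t, x) ↦ N[θ(t,·)](x)` lies in the (compact, if `T` is) set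
`{(t, y + z) : (t, y) ∈ T, |z| ≤ ρ₁}`. [folklore] -/
theorem tsupport_uncurry_slice_subset_image {θ : ℝ → EuclideanSpace ℝ (Fin 3) → ℝ}
    {N : ℝ → EuclideanSpace ℝ (Fin 3) → ℝ} (hθc : HasCompactSupport (uncurry θ))
    (hN : ∀ t x, (∀ z : EuclideanSpace ℝ (Fin 3), ‖z‖ ≤ ρ₁ → θ t (x - z) = 0) → N t x = 0) :
    tsupport (uncurry N) ⊆
      (fun q : (ℝ × EuclideanSpace ℝ (Fin 3)) × EuclideanSpace ℝ (Fin 3) =>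
        ((q.1.1, q.1.2 + q.2) : ℝ × EuclideanSpace ℝ (Fin 3))) ''
        (tsupport (uncurry θ) ×ˢ closedBall (0 : EuclideanSpace ℝ (Fin 3)) ρ₁) := by
  set Φ := fun q : (ℝ × EuclideanSpace ℝ (Fin 3)) × EuclideanSpace ℝ (Fin 3) =>
    ((q.1.1, q.1.2 + q.2) : ℝ × EuclideanSpace ℝ (Fin 3)) with hΦ
  have hΦc : Continuous Φ :=
    (continuous_fst.comp continuous_fst).prodMk
      ((continuous_snd.comp continuous_fst).add continuous_snd)
  have hTc : IsCompact
      (Φ '' (tsupport (uncurry θ) ×ˢ closedBall (0 : EuclideanSpace ℝ (Fin 3)) ρ₁)) :=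
    (hθc.prod (isCompact_closedBall _ _)).image hΦc
  refine closure_minimal (fun q hq => ?_) hTc.isClosed
  obtain ⟨t, x⟩ := q
  by_contra hnot
  refine hq (hN t x fun z hz => ?_)
  by_contra hne
  exact hnot ⟨((t, x - z), z), ⟨subset_tsupport _ (by exact hne), mem_closedBall_zero_iff.2 hz⟩,
    by simp [hΦ]⟩

variable {a b R : ℝ} {xB : EuclideanSpace ℝ (Fin 3)} {θ : ℝ → EuclideanSpace ℝ (Fin 3) → ℝ}

/-- The image set of `tsupport_uncurry_slice_subset_image` lies in the cylinder
`I × B(x_B, R + ρ₁)` when `tsupport θ ⊆ I × B(x_B, R)`. [folklore] -/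
theorem image_tsupport_subset_cylinder
    (hθ : tsupport (uncurry θ) ⊆ Ioo a b ×ˢ ball xB R) :
    (fun q : (ℝ × EuclideanSpace ℝ (Fin 3)) × EuclideanSpace ℝ (Fin 3) =>
        ((q.1.1, q.1.2 + q.2) : ℝ × EuclideanSpace ℝ (Fin 3))) ''
        (tsupport (uncurry θ) ×ˢ closedBall (0 : EuclideanSpace ℝ (Fin 3)) ρ₁) ⊆
      Ioo a b ×ˢ ball xB (R + ρ₁) := by
  rintro _ ⟨⟨⟨t, y⟩, z⟩, ⟨hty, hz⟩, rfl⟩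
  obtain ⟨ht, hy⟩ := hθ hty
  refine ⟨ht, ?_⟩
  rw [mem_ball] at hy ⊢
  rw [mem_closedBall_zero_iff] at hz
  calc dist (y + z) xB ≤ dist (y + z) y + dist y xB := dist_triangle _ _ _
    _ = ‖z‖ + dist y xB := by rw [dist_eq_norm, add_sub_cancel_left]
    _ < R + ρ₁ := by linarith

/-- **The slicewise truncated potential of a test function on a cylinder is a test function on
the `ρ₁`-enlarged cylinder**: for `θ ∈ C_c^∞(I × B(x_B, R))`, `I = (a, b)`, and
`0 ≤ ρ₀ < ρ₁`, `Θ(t, x) = N[θ(t, ·)](x)` belongs to `C_c^∞(I × B(x_B, R + ρ₁))`. [folklore] -/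
theorem IsSpaceTimeTestOn.newtonNearPotential_slice
    (hθ : IsSpaceTimeTestOn (⟨Ioo a b ×ˢ ball xB R, isOpen_Ioo.prod isOpen_ball⟩ :
      Opens (ℝ × EuclideanSpace ℝ (Fin 3))) θ) (h₀ : 0 ≤ ρ₀) (h₁ : ρ₀ < ρ₁) :
    IsSpaceTimeTestOn (⟨Ioo a b ×ˢ ball xB (R + ρ₁), isOpen_Ioo.prod isOpen_ball⟩ :
      Opens (ℝ × EuclideanSpace ℝ (Fin 3))) (fun t => newtonNearPotential ρ₀ ρ₁ (θ t)) := by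
  have hsub := tsupport_uncurry_slice_subset_image (ρ₁ := ρ₁) (N := fun t =>
    newtonNearPotential ρ₀ ρ₁ (θ t)) hθ.hasCompactSupport
    (fun t x hx => newtonNearPotential_eq_zero_of_forall h₀ h₁ hx)
  have hΦc : Continuous (fun q : (ℝ × EuclideanSpace ℝ (Fin 3)) × EuclideanSpace ℝ (Fin 3) =>
      ((q.1.1, q.1.2 + q.2) : ℝ × EuclideanSpace ℝ (Fin 3))) :=
    (continuous_fst.comp continuous_fst).prodMk
      ((continuous_snd.comp continuous_fst).add continuous_snd)
  refine ⟨contDiff_uncurry_newtonNearPotential_slice hθ h₀ h₁, ?_, ?_⟩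
  · exact IsCompact.of_isClosed_subset
      ((hθ.hasCompactSupport.prod (isCompact_closedBall _ _)).image hΦc) (isClosed_tsupport _)
      hsub
  · exact hsub.trans (image_tsupport_subset_cylinder hθ.tsupport_subset)

/-- The support of the slicewise smoothing remainder `(t, x) ↦ Λ[θ(t,·)](x)` of
`θ ∈ C_c^∞(I × B(x_B, R))` lies in `I × B(x_B, R + ρ₁)`, and it has compact support. [folklore] -/
theorem tsupport_newtonFarSmoothing_slice_subset
    (hθ : IsSpaceTimeTestOn (⟨Ioo a b ×ˢ ball xB R, isOpen_Ioo.prod isOpen_ball⟩ :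
      Opens (ℝ × EuclideanSpace ℝ (Fin 3))) θ) (h₀ : 0 ≤ ρ₀) (h₁ : ρ₀ < ρ₁) :
    HasCompactSupport (uncurry fun t => newtonFarSmoothing ρ₀ ρ₁ (θ t)) ∧
      tsupport (uncurry fun t => newtonFarSmoothing ρ₀ ρ₁ (θ t)) ⊆ Ioo a b ×ˢ ball xB (R + ρ₁) := by
  have hsub := tsupport_uncurry_slice_subset_image (ρ₁ := ρ₁) (N := fun t =>
    newtonFarSmoothing ρ₀ ρ₁ (θ t)) hθ.hasCompactSupport
    (fun t x hx => newtonFarSmoothing_eq_zero_of_forall h₀ h₁ hx)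
  have hΦc : Continuous (fun q : (ℝ × EuclideanSpace ℝ (Fin 3)) × EuclideanSpace ℝ (Fin 3) =>
      ((q.1.1, q.1.2 + q.2) : ℝ × EuclideanSpace ℝ (Fin 3))) :=
    (continuous_fst.comp continuous_fst).prodMk
      ((continuous_snd.comp continuous_fst).add continuous_snd)
  exact ⟨IsCompact.of_isClosed_subset
      ((hθ.hasCompactSupport.prod (isCompact_closedBall _ _)).image hΦc) (isClosed_tsupport _)
      hsub, hsub.trans (image_tsupport_subset_cylinder hθ.tsupport_subset)⟩

/-! ### The Hessian quadratic form against coordinate second derivatives -/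

/-- **`|D²g(x)(v, v)| ≤ ‖v‖² ∑ᵢ ∑ⱼ |∂ⱼ∂ᵢ g(x)|`** for `g ∈ C²` on a finite-dimensional real inner
product space with orthonormal basis `b` (expand `v = ∑ ⟪v, bᵢ⟫ bᵢ`, `|⟪v, bᵢ⟫| ≤ ‖v‖`).
[folklore] -/
theorem abs_fderiv_fderiv_apply_le_norm_sq_mul_sum {E : Type*} [NormedAddCommGroup E]
    [InnerProductSpace ℝ E] {ι : Type*} [Fintype ι] (bs : OrthonormalBasis ι ℝ E) {g : E → ℝ}
    (hg : ContDiff ℝ 2 g) (x v : E) :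
    |fderiv ℝ (fun y => fderiv ℝ g y v) x v| ≤
      ‖v‖ ^ 2 * ∑ i, ∑ j, |fderiv ℝ (fun y => fderiv ℝ g y (bs i)) x (bs j)| := by
  rw [fderiv_fderiv_apply_eq_sum bs hg x v, Finset.mul_sum]
  refine (Finset.abs_sum_le_sum_abs _ _).trans (Finset.sum_le_sum fun i _ => ?_)
  rw [Finset.mul_sum]
  refine (Finset.abs_sum_le_sum_abs _ _).trans (Finset.sum_le_sum fun j _ => ?_)
  rw [abs_mul, abs_mul]
  have hi : |⟪v, bs i⟫| ≤ ‖v‖ := by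
    refine (abs_real_inner_le_norm _ _).trans ?_
    rw [bs.orthonormal.1 i, mul_one]
  have hj : |⟪v, bs j⟫| ≤ ‖v‖ := by
    refine (abs_real_inner_le_norm _ _).trans ?_
    rw [bs.orthonormal.1 j, mul_one]
  calc |⟪v, bs i⟫| * |⟪v, bs j⟫| * |fderiv ℝ (fun y => fderiv ℝ g y (bs i)) x (bs j)|
      ≤ ‖v‖ * ‖v‖ * |fderiv ℝ (fun y => fderiv ℝ g y (bs i)) x (bs j)| := by
        gcongr
    _ = ‖v‖ ^ 2 * |fderiv ℝ (fun y => fderiv ℝ g y (bs i)) x (bs j)| := by ring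

end Literature.Analysis.FluidPDE
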